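import Literature.MathematicalPhysics.QuantumFieldTheory.Balaban1983to89.B9B8KnitBondAvgSupport
import Literature.MathematicalPhysics.QuantumFieldTheory.Balaban1983to89.B9Eq316AveragingTransposeZdPrinted
import Literature.MathematicalPhysics.QuantumFieldTheory.Balaban1983to89.B9Eq332AveragingLetterCovarianceZd

/-!
# `Balaban1983to89.B9B8KnitFlatAveragingAgreement` — the (B)-line bond junction, file c2 (part IV): THE FLAT AGREEMENT OF THE AVERAGING LETTERS —
# at the trivial background, def-Y's `Q*(1)aQ(1)` ([4] (3.26), r03's kernels `qKᵀ·diag(w)·qK`) at a constant-level-`n` member with the band weight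
# `w = c_f²·(Lⁿ)^{d+1}·(Lⁿ)^{-2}` (`b₀ = 1`) EQUALS `(c_fη)²` times the descent of the [Balaban1985RegularSpaces] knit's genuine averaging letter
# `QQZdP` ([B8] (1.58), `a = 1`) of the periodic lift, bond by bond: the `ε_Q = 0` instance of the averaging closeness (c′) at `U₀ = 1`

statement-level skeleton of published theorems with citation tags; proofs where landed; nothing here is a claim about the
Yang–Mills mass gap

Sub-row G-B8-T2S (unit `lit-balaban-t2s-1`, gen 7), RULING #10 road, crux (c′) (design `lit-balaban-t2s-1/g7/BLINE-DESIGN-g7.md` §1, §3).  This is the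
CONSISTENCY CERTIFICATE of the displayed averaging-closeness hypothesis `hQQ` of files 5 ∕ 8c (`B9B8KnitClosenessOfSectors.sockB9P3Per_torusIdx_of_sectors`):
at `U₀ = 1` the two letters agree EXACTLY when the member carries the band weight at `b₀ = 1` (`B8Thm2TorusMemberWeighted.exists_constLev_member_weight`) —
so the normalisations of the junction are right (cf. the Landau finding of file 7c′: a mis-normalised letter would make `hQQ` unsatisfiable).  Assembly of
parts I–III: the knit side is `w_n·Σ_{κ,t} (flat column)ᵀ(class field)` over the `2(d+1)` window bonds (`linCovIterT`), the columns are `Lⁿ·qK ι_{κ,t} f`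
(part II) and vanish unless `κ = f.dir` (part III), the class field is `η·LⁿQ_n^{flat}(a♯) = ηLⁿ·(Q(1)a)(ι)` (parts I, III); def-Y's side is `Σ_ι qK ι f·w_ι·(Q(1)a)(ι)`
over ALL index bonds, supported on the two window bonds of direction `f.dir` (part III); the scalars `(c_fη)²·w_n·Lⁿ·ηLⁿ = c_f²·(Lⁿ)^{d+1}(Lⁿ)^{-2}` match.
Print: [4] (3.12)–(3.13) pp. 392–393, (3.16) p. 393, (3.26) p. 395; [B8] (1.58) p. 86, p. 77 («Ω_j = T_η»); [3] (1.18) p. 20; [5] (127) p. 37; [B6] (2.16), (2.18)–(2.20) pp. 225–226.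

WHAT IS PROVED (kernel, 0 sorry; theorems only, no `def`, no `… : Prop` fact, no `instance`).
* §1 `aY_apply` (`(aΛ)(ι) = w_ι·Λ(ι)`), `QsY_one_apply` (`(Q*(1)Λ)(f) = Σ_ι qK ι f·Λ(ι)`), `two_le_sitesPerDir`, `ιOf_injective`-type lemma `transl_winBase_ne`.
* §2 ★★★ `QsY_aY_QY_one_eq_QQZdP_one` — THE FLAT AGREEMENT: `(Q*(1)aQ(1)a)(f) = (c_fη)²·(QQZdP(1)(a♯))♭(f)` for every bond function `a` and fine bond `f`, at a
  constant-level-`n` member (nominal index `n + 1`) with the `b₀ = 1` band weight, the torus datum `torusIdx ⟨η, k⟩` and any faithful tracial `τ`.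

HONEST SCOPE.  The FLAT (`U₀ = 1`, `ε_Q = 0`) case of (c′) only; the curved comparison (c4–c6) is NOT here; count-neutral; nothing continuum ∕ ℝ⁴ ∕ OS ∕ mass
gap ∕ Clay — the Yang–Mills mass gap is NOT proved here.  NEW file; parts I–III, c1, c2a, dag-n06's letters are used BY NAME, nothing landed is modified.
-/

noncomputable section

namespace Literature.MathematicalPhysics.QuantumFieldTheory.Balaban1983to89.B9B8KnitFlatAveragingAgreement

open scoped BigOperators
open Node00
open B7Prop1Explicit renaming Site → LSite
open B7Prop1Explicit (e e_apply)
open B6KLevelCensusIndexV1 (KIdx)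
open B6GlobalChartV1 (PV)
open B7Prop4Flat (linQIter)
open B7Prop4GeneralLevels (linCovIter)
open B7Prop5Flat (bump)
open B10Eq27TorusAxialLog (transl transl_apply rel transl_rel)
open B9B8KnitBondTransfer (liftBd liftBd_apply descBd descBd_apply)
open B9B8KnitBondAvgDictionary (linQIter_liftBd_eq_QY_one)
open B9B8KnitBondAvgColumns (exists_ibondY_of_constLev transl_zero_eq_iff_of_abs_lt entryT_flatColumn_eq_smul_qK)
open B9B8KnitBondAvgSupport (window_winBase ibondY_eq_of_key_eq dir_eq_of_qK_ne_zero src_eq_winBase_of_qK_ne_zero clsField_of_ne clsField_one_top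
  linCovIter_one_bump)
open B8Thm2TorusMemberWeighted (ibondY_level_eq)
open B9Eq316AveragingTransposeZd (entryT winBase clsField wQ linCovIterT alphaQ alphaQ_pos reg17_one)
open B9Eq316AveragingTransposeZdPrinted (QQZdP QQZdP_of_reg17)
open B9Eq332AveragingLetterCovarianceZd (entryT_zero')
open B8Thm2TorusMember (TorusMember torusIdx torusLamb)
open B9Eq39Adjoint (R R_one)

variable {d ℓ : ℕ} {hd : 1 ≤ d + 1} {hL : Odd (ℓ + 1) ∧ 1 < ℓ + 1} {b₀ b₁ : ℝ}

/-! ## §1 def-Y's letters at the trivial transporters, entry by entry -/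

section Letters

variable {𝔸 : Type} [NormedRing 𝔸] [NormedAlgebra ℂ 𝔸] [CompleteSpace 𝔸] (i : KIdx d ℓ hd hL b₀ b₁)

omit [CompleteSpace 𝔸] in
/-- `(aΛ)(ι) = w_ι·Λ(ι)` (NODE 00's weight matrix is diagonal, `aK_eq_diagonal`). [cite: Balaban1984PropagatorsII, (2.20) p.226; Balaban1985BackgroundPropagators, (3.26) p.395] -/
theorem aY_apply (Λ : IBondY i → 𝔸) (ι : IBondY i) : aY i Λ ι = ((i.w ι : ℝ) : ℂ) • Λ ι := by
  classical
  rw [aY, liftMatY_apply, aK_eq_diagonal]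
  rw [Finset.sum_eq_single ι]
  · rw [Matrix.diagonal_apply_eq]
  · intro ι' _ hι'
    rw [Matrix.diagonal_apply_ne _ (Ne.symm hι'), Complex.ofReal_zero, zero_smul]
  · intro h
    exact absurd (Finset.mem_univ _) h

/-- `(Q*(1)Λ)(f) = Σ_ι qK ι f·Λ(ι)` at trivial transporters (`qsK = qKᵀ`, `R(1) = id`). [cite: Balaban1985BackgroundPropagators, (3.13) p.393] -/
theorem QsY_one_apply (parB : BondParY 𝔸 i) (hpar : ∀ z w, parB (fun _ _ => (1 : 𝔸ˣ)) z w = 1) (Λ : IBondY i → 𝔸) (f : FBondY i) :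
    QsY i parB (fun _ _ => (1 : 𝔸ˣ)) Λ f = ∑ ι, ((qK i ι f : ℝ) : ℂ) • Λ ι := by
  rw [QsY, trLiftY_apply]
  refine Finset.sum_congr rfl fun ι _ => ?_
  rw [qsK_eq_transpose, Matrix.transpose_apply, qT, hpar, inv_one, R_one]

end Letters

/-! ## §2 The flat agreement -/

section Agreement

variable {m K : ℕ}

/-- every V1 torus has at least two sites per direction. [cite: Balaban1987RG1, (0.1) p.251, bookkeeping] -/
theorem two_le_sitesPerDir (j : ℕ) : 2 ≤ (PV d ℓ m K hd hL).sitesPerDir j := by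
  show 2 ≤ 2 * (ℓ + 1) ^ (m + K - j)
  exact Nat.le_mul_of_pos_right _ (by positivity)

/-- the two window bonds of one direction are different torus bonds: `0 + winBase L j y μ 0 ≠ 0 + winBase L j y μ 1` on `T^{(j)}`.
[cite: Balaban1985Averaging, p.24 (after (43)), bookkeeping] -/
theorem transl_winBase_injective {L j : ℕ} (y : LSite (d + 1)) (μ : Fin (d + 1)) {t t' : Fin 2}
    (h : transl (0 : Site (PV d ℓ m K hd hL) j) (winBase L j y μ t) = transl (0 : Site (PV d ℓ m K hd hL) j) (winBase L j y μ t')) : t = t' := by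
  have hlt : ∀ ν, |winBase L j y μ t ν - winBase L j y μ t' ν| < ((PV d ℓ m K hd hL).sitesPerDir j : ℕ) := by
    intro ν
    have h2 : (2 : ℤ) ≤ ((PV d ℓ m K hd hL).sitesPerDir j : ℕ) := by exact_mod_cast two_le_sitesPerDir (d := d) (hd := hd) (hL := hL) j
    have ht : ((t : ℕ) : ℤ) = 0 ∨ ((t : ℕ) : ℤ) = 1 := by have := t.2; omega
    have ht' : ((t' : ℕ) : ℤ) = 0 ∨ ((t' : ℕ) : ℤ) = 1 := by have := t'.2; omega
    unfold winBase
    by_cases hν : ν = μ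
    · rw [if_pos hν, if_pos hν, abs_lt]
      rcases ht with h0 | h0 <;> rcases ht' with h1 | h1 <;> rw [h0, h1] <;> constructor <;> linarith
    · rw [if_neg hν, if_neg hν, sub_zero, sub_self, abs_zero]
      positivity
  have heq := (transl_zero_eq_iff_of_abs_lt (d := d) (ℓ := ℓ) (m := m) (K := K) (hd := hd) (hL := hL) hlt).1 h
  have hμ := congrFun heq μ
  unfold winBase at hμ
  simp only [if_true] at hμ
  apply Fin.ext
  have : ((t : ℕ) : ℤ) = ((t' : ℕ) : ℤ) := by linarith
  exact_mod_cast this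

variable {𝔸 : Type} [CStarAlgebra 𝔸] [Nontrivial 𝔸] [FiniteDimensional ℝ 𝔸] (τ : 𝔸 →ₗ[ℂ] ℂ) (i : KIdx d ℓ hd hL b₀ b₁) {n : ℕ}

/-- ★★★ **THE FLAT AGREEMENT OF THE AVERAGING LETTERS** (`U₀ = 1`, `ε_Q = 0`): at a member of constant level `n` (nominal index `n + 1`) carrying the band
weight `w_ι = c_f²·(Lⁿ)^{d+1}·(1∕Lⁿ)²` (`b₀ = 1`), with trivial def-Y transporters and any faithful tracial `τ`:
`(Q*(1)·a·Q(1) a)(f) = (c_fη)²·(QQZdP τ L torusLamb (torusIdx ⟨η,k⟩) n 1 (a♯))♭(f)` for every bond function `a` and every fine bond `f`.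
[cite: Balaban1985BackgroundPropagators, (3.12)–(3.13) p.392, (3.16) p.393, (3.26) p.395; Balaban1985RegularSpaces, (1.58) p.86, p.77 («Ω_j = T_η»); Balaban1984PropagatorsI, (1.18) p.20; Balaban1985Averaging, (127) p.37] -/
theorem QsY_aY_QY_one_eq_QQZdP_one (hτp : ∀ a : 𝔸, a ≠ 0 → 0 < (τ (star a * a)).re) (hτt : ∀ a b : 𝔸, τ (a * b) = τ (b * a))
    (hD : ∀ x, i.D.lev x = n) (hk : i.k = n + 1)
    (hw : ∀ ι : IBondY i, i.w ι = i.cf ^ 2 * (((((ℓ + 1 : ℕ) : ℝ)) ^ (ι.1.1 : ℕ)) ^ (d + 1) * (1 / (((ℓ + 1 : ℕ) : ℝ)) ^ (ι.1.1 : ℕ)) ^ 2))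
    (hL1 : 1 ≤ ℓ + 1) {η : ℝ} (hη : 0 < η) {k : ℕ} (hk1 : 1 ≤ k)
    (parB : BondParY 𝔸 i) (hpar : ∀ z w, parB (fun _ _ => (1 : 𝔸ˣ)) z w = 1) (a : FBondY i → 𝔸) (f : FBondY i) :
    QsY i parB (fun _ _ => (1 : 𝔸ˣ)) (aY i (QY i parB (fun _ _ => (1 : 𝔸ˣ)) a)) f =
      ((i.cf * η) ^ 2 : ℝ) • descBd i (QQZdP τ (ℓ + 1) (fun m' => torusLamb (d := d + 1) m') (torusIdx (d := d + 1) hL1 ⟨η, hη, k, hk1⟩) n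
        (1 : LSite (d + 1) → Fin (d + 1) → 𝔸ˣ) (liftBd i a)) f := by
  classical
  -- notation
  set y : LSite (d + 1) := rel (0 : Site (PV d ℓ i.m i.K hd hL) 0) f.src with hydef
  set μ : Fin (d + 1) := f.dir with hμdef
  set N : ℝ := (((ℓ + 1 : ℕ) : ℝ)) ^ n with hNdef
  have hN0 : 0 < N := by positivity
  have hf : (⟨transl (0 : Site (PV d ℓ i.m i.K hd hL) 0) y, μ⟩ : FBondY i) = f := by
    rw [hydef, transl_rel]
  have e1 : ∀ (j j' : ℕ) (w : LSite (d + 1)), j = j' →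
      rel (0 : Site (PV d ℓ i.m i.K hd hL) j) (transl (0 : Site (PV d ℓ i.m i.K hd hL) j) w) =
        rel (0 : Site (PV d ℓ i.m i.K hd hL) j') (transl (0 : Site (PV d ℓ i.m i.K hd hL) j') w) := by
    rintro j j' w rfl; rfl
  -- the index bonds over the window bonds
  choose ιOf hlev hsrc hdir using fun (κ : Fin (d + 1)) (t : Fin 2) =>
    exists_ibondY_of_constLev i hD hk (winBase (ℓ + 1) n y κ t) κ
  set V : Fin 2 → 𝔸 := fun t => QY i parB (fun _ _ => (1 : 𝔸ˣ)) a (ιOf μ t) with hVdef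
  -- windows (at the level of each `ιOf κ t`)
  have hwin : ∀ κ t ν, ((((ℓ + 1) ^ ((ιOf κ t).1.1 : ℕ) : ℕ)) : ℤ) * winBase (ℓ + 1) n y κ t ν ≤ y ν ∧
      y ν < ((((ℓ + 1) ^ ((ιOf κ t).1.1 : ℕ) : ℕ)) : ℤ) * winBase (ℓ + 1) n y κ t ν + 2 * ((((ℓ + 1) ^ ((ιOf κ t).1.1 : ℕ) : ℕ)) : ℤ) := by
    intro κ t ν
    rw [hlev κ t]
    exact window_winBase hL1 n y κ t ν
  -- the flat knit columns: `(column)ᵀ v = (N·qK (ιOf κ t) f)·v`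
  have hcol : ∀ κ t (v : 𝔸), entryT τ (fun X : 𝔸 => linCovIter (ℓ + 1) (1 : LSite (d + 1) → Fin (d + 1) → 𝔸ˣ) (bump y μ X) n
      (winBase (ℓ + 1) n y κ t) κ) v = ((N * qK i (ιOf κ t) f : ℝ) : ℂ) • v := by
    intro κ t v
    have h := entryT_flatColumn_eq_smul_qK τ i hτp hτt (ιOf κ t) (winBase (ℓ + 1) n y κ t) y μ (hsrc κ t).symm (hwin κ t) v
    rw [hdir κ t] at h
    rw [hlev κ t] at h
    rw [hf] at h
    rw [linCovIter_one_bump hL1]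
    exact h
  -- columns of the wrong direction vanish
  have hdirv : ∀ κ t, κ ≠ μ → qK i (ιOf κ t) f = 0 := by
    intro κ t hκ
    by_contra hne
    exact hκ ((hdir κ t).symm.trans (dir_eq_of_qK_ne_zero i hne))
  -- the top class field of the lift at the window bonds of direction `μ`
  have hcls : ∀ t, clsField (ℓ + 1) (fun m' => torusLamb (d := d + 1) m') η n n (1 : LSite (d + 1) → Fin (d + 1) → 𝔸ˣ) (liftBd i a)
      (winBase (ℓ + 1) n y μ t) μ = ((η * N : ℝ) : ℂ) • V t := by
    intro t
    rw [clsField_one_top hL1 η n (norm_nonneg a) (fun x κ => by rw [liftBd_apply]; exact norm_le_pi_norm a _)]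
    have h := linQIter_liftBd_eq_QY_one i parB hpar (ιOf μ t) (winBase (ℓ + 1) n y μ t) (hsrc μ t).symm a
    rw [hdir μ t] at h
    rw [hlev μ t] at h
    rw [h, smul_smul, ← Complex.ofReal_mul]
  -- ===== the knit side =====
  have hK : descBd i (QQZdP τ (ℓ + 1) (fun m' => torusLamb (d := d + 1) m') (torusIdx (d := d + 1) hL1 ⟨η, hη, k, hk1⟩) n
      (1 : LSite (d + 1) → Fin (d + 1) → 𝔸ˣ) (liftBd i a)) f =
      ∑ t : Fin 2, ((wQ (d := d + 1) (ℓ + 1) η n * (N * qK i (ιOf μ t) f) * (η * N) : ℝ) : ℂ) • V t := by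
    rw [descBd_apply]
    have hreg := reg17_one (𝔸 := 𝔸) (d := d + 1) hL1 (m := n) (Ω := fun _ => (Set.univ : Set (LSite (d + 1))))
      (α := alphaQ (d + 1) (ℓ + 1) / ((ℓ + 1 : ℕ) : ℝ) ^ 2) (div_pos (alphaQ_pos (d + 1) hL1) (by positivity))
    rw [QQZdP_of_reg17 τ (ℓ + 1) (i := torusIdx (d := d + 1) hL1 ⟨η, hη, k, hk1⟩) hreg]
    rw [Finset.sum_eq_single n]
    · -- the top level
      show (wQ (d := d + 1) (ℓ + 1) η n) • linCovIterT τ (ℓ + 1) 1 n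
          (clsField (ℓ + 1) (fun m' => torusLamb (d := d + 1) m') η n n 1 (liftBd i a)) y μ = _
      unfold linCovIterT
      rw [Finset.sum_eq_single μ]
      · rw [Finset.smul_sum]
        refine Finset.sum_congr rfl fun t _ => ?_
        rw [hcol μ t, hcls t, smul_smul, ← Complex.coe_smul, smul_smul]
        congr 1
        push_cast
        ring
      · intro κ _ hκ
        refine Finset.sum_eq_zero fun t _ => ?_
        rw [hcol κ t, hdirv κ t hκ, mul_zero, Complex.ofReal_zero, zero_smul]
      · intro h; exact absurd (Finset.mem_univ _) h
    · intro j _ hj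
      show (wQ (d := d + 1) (ℓ + 1) η j) • linCovIterT τ (ℓ + 1) 1 j
          (clsField (ℓ + 1) (fun m' => torusLamb (d := d + 1) m') η n j 1 (liftBd i a)) y μ = 0
      rw [clsField_of_ne η hj]
      unfold linCovIterT
      simp only [Pi.zero_apply, entryT_zero', Finset.sum_const_zero, smul_zero]
    · intro h
      exact absurd (Finset.mem_range.2 (Nat.lt_succ_self n)) h
  -- ===== def-Y's side =====
  have hY : QsY i parB (fun _ _ => (1 : 𝔸ˣ)) (aY i (QY i parB (fun _ _ => (1 : 𝔸ˣ)) a)) f =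
      ∑ t : Fin 2, ((qK i (ιOf μ t) f * (i.cf ^ 2 * (N ^ (d + 1) * (1 / N) ^ 2)) : ℝ) : ℂ) • V t := by
    rw [QsY_one_apply i parB hpar]
    -- restrict the sum over all index bonds to the two window bonds of direction `μ`
    have hsupp : ∀ ι : IBondY i, qK i ι f ≠ 0 → ι ∈ Finset.image (fun t => ιOf μ t) Finset.univ := by
      intro ι hι
      obtain ⟨t, ht⟩ := src_eq_winBase_of_qK_ne_zero i hι
      have hdι := dir_eq_of_qK_ne_zero i hι
      have hlι := ibondY_level_eq i hD hk ι
      have hwb : winBase (ℓ + 1) ((ι.1.1 : ℕ)) (rel (0 : Site (PV d ℓ i.m i.K hd hL) 0) f.src) f.dir t = winBase (ℓ + 1) n y μ t := by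
        rw [hlι]
      refine Finset.mem_image.2 ⟨t, Finset.mem_univ _, (ibondY_eq_of_key_eq i ?_ ?_ ?_).symm⟩
      · rw [hlι, hlev μ t]
      · rw [ht, hsrc μ t, hwb]
        exact e1 _ _ _ (hlι.trans (hlev μ t).symm)
      · rw [hdι, hdir μ t]
    have hinj : Function.Injective fun t : Fin 2 => ιOf μ t := by
      intro t t' htt
      have h1 := hsrc μ t
      have h2 := hsrc μ t'
      simp only at htt
      have hkey : rel (0 : Site (PV d ℓ i.m i.K hd hL) ((ιOf μ t).1.1 : ℕ)) (ιOf μ t).1.2.src =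
          rel (0 : Site (PV d ℓ i.m i.K hd hL) ((ιOf μ t').1.1 : ℕ)) (ιOf μ t').1.2.src := by rw [htt]
      rw [h1, h2, e1 _ n _ (hlev μ t), e1 _ n _ (hlev μ t')] at hkey
      have htr := congrArg (transl (0 : Site (PV d ℓ i.m i.K hd hL) n)) hkey
      rw [transl_rel, transl_rel] at htr
      exact transl_winBase_injective (d := d) (hd := hd) (hL := hL) y μ htr
    rw [← Finset.sum_subset (Finset.subset_univ (Finset.image (fun t => ιOf μ t) Finset.univ))
      (fun ι _ hι => by
        have hq : qK i ι f = 0 := by by_contra hne; exact hι (hsupp ι hne)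
        rw [hq, Complex.ofReal_zero, zero_smul]),
      Finset.sum_image (fun t _ t' _ h => hinj h)]
    refine Finset.sum_congr rfl fun t _ => ?_
    rw [aY_apply, hw (ιOf μ t), hlev μ t, smul_smul, ← Complex.ofReal_mul]
  -- ===== the scalars =====
  have hη0 : η ≠ 0 := hη.ne'
  have hwQ : wQ (d := d + 1) (ℓ + 1) η n = ((N * η) ^ 3)⁻¹ * (N ^ (d + 1) * N⁻¹) := rfl
  have hscal : ∀ q : ℝ, q * (i.cf ^ 2 * (N ^ (d + 1) * (1 / N) ^ 2)) = (i.cf * η) ^ 2 * (wQ (d := d + 1) (ℓ + 1) η n * (N * q) * (η * N)) := by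
    intro q
    rw [hwQ]
    field_simp
  rw [hY, hK, ← Complex.coe_smul, Finset.smul_sum]
  refine Finset.sum_congr rfl fun t _ => ?_
  rw [smul_smul, ← Complex.ofReal_mul, hscal]

end Agreement

end Literature.MathematicalPhysics.QuantumFieldTheory.Balaban1983to89.B9B8KnitFlatAveragingAgreement
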